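import Mathlib.Data.Finset.Sum
import Literature.Computability.AlgebraicComplexity.LRCanonicalSubspaces
import HarnessLib

/-!
# Landsberg–Ressayre, Thm. 2.1 — two-sided canonical subspaces of an equivariant pencil (LR17 §3.6)

Topic `Literature/Computability/AlgebraicComplexity`.  First file of the bottom-up proof of the
named fact `lr_full_equivariant_lower` (`LandsbergRessayre.lean`; LR17 Thm. 2.1, lower bound: an
affine determinantal representation of `perm_m`, `m ≥ 3`, equivariant for the left AND right
monomial symmetries has size `n ≥ C(2m, m) - 1`).  It is the two-sided companion of
`LRCanonicalSubspaces.lean` (which serves LR17 Thm. 2.8, the left symmetries only): LR17 prove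
Thm. 2.1 by "a proof very similar to the proof of Theorem (th:srdcdet)" (LR17 §6, last line), i.e.
the chain-of-modules argument of §3.6/§5/§6 run with the torus `T(E) × T(F)` and the permutations
`𝔖_m × 𝔖_m` on both sides.  As in the one-sided file, LR's irreducible `L'`-modules are replaced
by CANONICAL subspaces of the linear-algebra datum `Ã = Λ + Σ x_{kj} A_{kj}`, now indexed by a
set `S ⊆ [m] ⊔ [m]` of rows AND columns (a finset of the sum type `Fin m ⊕ Fin m`):

* `IsClosedUnder₂ Λ A S P`: `A_{kj} (Λ⁻¹ P) ⊆ P` whenever `inl k ∈ S` and `inr j ∈ S`;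
* `canon₂ Λ A S = 𝒫_S`: the least such subspace; `canon₂ Λ A univ = canon Λ A univ`, so the
  escape lemma `not_canon_univ_le_range` of the one-sided file applies verbatim;
* `Lift₂ Λ A σ τ c`: an exact lift `(B, C)` of the two-sided monomial symmetry
  `x ↦ P_σ diag(c_inl) · x · (P_τ diag(c_inr))ᵀ`: `B Λ = Λ C` and
  `B A_{kj} = c_{inl k} c_{inr j} · A_{σ k, τ j} C` (LR17 Def. 1.3 unpacked on the constant and the
  linear part, for the group `(N(T^{GL(E)}) × N(T^{GL(F)}))`, LR17 §2.1);
* COVARIANCE `map_canon₂_eq`: `B 𝒫_S = 𝒫_{(σ ⊔ τ) S}`, and the transports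
  `canon₂_le_range_iff`, `canon₂_le_iSup_ssubsets_transfer`.

Everything is linear algebra over a field; the torus weights enter in `LR21TorusWeights.lean`.

## References

* J. M. Landsberg, N. Ressayre, *Permanent v. determinant: an exponential lower bound assuming
  symmetry and a potential path towards Valiant's conjecture*, Differential Geom. Appl. 55 (2017)
  146–166, arXiv:1508.05788: §2.1 (`𝔾_{perm_m}`), §3.6 (outline), §6 (proofs of Thms. 2.8, 2.1).
-/

noncomputable section

namespace Literature.Computability.AlgebraicComplexity

namespace LRPencil

open Submodule

variable {K : Type*} [Field K] {V : Type*} [AddCommGroup V] [Module K V] {m : ℕ}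

/-! ### Two-sided closed subspaces and the canonical subspaces `𝒫_S`, `S ⊆ [m] ⊔ [m]` -/

section Canon

variable (Λ : Module.End K V) (A : Fin m → Fin m → Module.End K V)

/-- `P` is closed under the rows and columns in `S ⊆ [m] ⊔ [m]`: `A_{kj} (Λ⁻¹ P) ⊆ P` whenever
the row `k` (as `inl k`) and the column `j` (as `inr j`) both lie in `S` (the inductive step
`ℍ_i ↦ ℍ_{i+1}` of LR17 §3.6 for the two-sided group, as a closure condition).
[cite: LandsbergRessayre2017, §3.6] -/
def IsClosedUnder₂ (S : Finset (Fin m ⊕ Fin m)) (P : Submodule K V) : Prop :=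
  ∀ k j : Fin m, Sum.inl k ∈ S → Sum.inr j ∈ S → (P.comap Λ).map (A k j) ≤ P

/-- The two-sided canonical subspace `𝒫_S`: the least subspace closed under the rows and columns
in `S` (LR17 §6: the span of the chain `ℍ_1, ℍ_2, …` built from `ker Λ`).
[cite: LandsbergRessayre2017, §6] -/
def canon₂ (S : Finset (Fin m ⊕ Fin m)) : Submodule K V :=
  sInf {P : Submodule K V | IsClosedUnder₂ Λ A S P}

variable {Λ A}

/-- Closedness is antitone in the index set. [cite: LandsbergRessayre2017, §6] -/
theorem IsClosedUnder₂.anti {S S' : Finset (Fin m ⊕ Fin m)} {P : Submodule K V}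
    (h : IsClosedUnder₂ Λ A S P) (hS : S' ⊆ S) : IsClosedUnder₂ Λ A S' P :=
  fun k j hk hj => h k j (hS hk) (hS hj)

/-- `𝒫_S` is closed under `S`. [cite: LandsbergRessayre2017, §6] -/
theorem isClosedUnder₂_canon₂ (S : Finset (Fin m ⊕ Fin m)) :
    IsClosedUnder₂ Λ A S (canon₂ Λ A S) := by
  intro k j hk hj
  refine le_sInf fun P hP => ?_
  have h1 : canon₂ Λ A S ≤ P := sInf_le hP
  exact (Submodule.map_mono (Submodule.comap_mono h1)).trans (hP k j hk hj)

/-- `𝒫_S` is the least closed subspace. [cite: LandsbergRessayre2017, §6] -/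
theorem canon₂_le {S : Finset (Fin m ⊕ Fin m)} {P : Submodule K V} (hP : IsClosedUnder₂ Λ A S P) :
    canon₂ Λ A S ≤ P :=
  sInf_le hP

/-- `𝒫_S` is monotone in `S`. [cite: LandsbergRessayre2017, §6] -/
theorem canon₂_mono {S S' : Finset (Fin m ⊕ Fin m)} (h : S' ⊆ S) : canon₂ Λ A S' ≤ canon₂ Λ A S :=
  canon₂_le ((isClosedUnder₂_canon₂ S).anti h)

/-- `A_{kj} (ker Λ) ⊆ 𝒫_S` for `inl k, inr j ∈ S` (LR17 §3.6: `ℍ_1`). [cite: LandsbergRessayre2017, §3.6] -/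
theorem map_ker_le_canon₂ {S : Finset (Fin m ⊕ Fin m)} {k j : Fin m} (hk : Sum.inl k ∈ S)
    (hj : Sum.inr j ∈ S) : (LinearMap.ker Λ).map (A k j) ≤ canon₂ Λ A S :=
  (Submodule.map_mono (ker_le_comap _)).trans (isClosedUnder₂_canon₂ S k j hk hj)

/-- `𝒫_S ⊆ Σ_{inl k, inr j ∈ S} A_{kj} Λ⁻¹ 𝒫_S`: every element of `𝒫_S` is produced by one more
step of the chain. [cite: LandsbergRessayre2017, §6] -/
theorem canon₂_le_step (S : Finset (Fin m ⊕ Fin m)) :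
    canon₂ Λ A S ≤ ⨆ (k : Fin m) (_ : Sum.inl k ∈ S), ⨆ (j : Fin m) (_ : Sum.inr j ∈ S),
      ((canon₂ Λ A S).comap Λ).map (A k j) := by
  set T : Submodule K V := ⨆ (k : Fin m) (_ : Sum.inl k ∈ S), ⨆ (j : Fin m) (_ : Sum.inr j ∈ S),
      ((canon₂ Λ A S).comap Λ).map (A k j) with hT
  have hTle : T ≤ canon₂ Λ A S :=
    iSup₂_le fun k hk => iSup₂_le fun j hj => isClosedUnder₂_canon₂ S k j hk hj
  apply canon₂_le
  intro k j hk hj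
  calc ((T.comap Λ).map (A k j)) ≤ ((canon₂ Λ A S).comap Λ).map (A k j) :=
        Submodule.map_mono (Submodule.comap_mono hTle)
    _ ≤ ⨆ (j : Fin m) (_ : Sum.inr j ∈ S), ((canon₂ Λ A S).comap Λ).map (A k j) :=
        le_biSup (fun j => ((canon₂ Λ A S).comap Λ).map (A k j)) hj
    _ ≤ T := by
        rw [hT]
        exact le_biSup (fun k => ⨆ (j : Fin m) (_ : Sum.inr j ∈ S),
          ((canon₂ Λ A S).comap Λ).map (A k j)) hk

/-- For the full index set, two-sided closedness is one-sided closedness under all rows. [folklore] -/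
theorem isClosedUnder₂_univ_iff (P : Submodule K V) :
    IsClosedUnder₂ Λ A Finset.univ P ↔ IsClosedUnder Λ A Finset.univ P :=
  ⟨fun h k _ j => h k j (Finset.mem_univ _) (Finset.mem_univ _),
    fun h k j _ _ => h k (Finset.mem_univ _) j⟩

/-- Hence `𝒫_{[m] ⊔ [m]}` is the one-sided `𝒫_{[m]}` of `LRCanonicalSubspaces.lean` (so that the
escape lemma `not_canon_univ_le_range` applies). [folklore] -/
theorem canon₂_univ : canon₂ Λ A (Finset.univ : Finset (Fin m ⊕ Fin m)) = canon Λ A Finset.univ := by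
  unfold canon₂ canon
  congr 1
  ext P
  exact isClosedUnder₂_univ_iff P

end Canon

/-! ### Two-sided lifts of monomial symmetries and covariance -/

section Lift

variable (Λ : Module.End K V) (A : Fin m → Fin m → Module.End K V)

/-- An EXACT LIFT of the two-sided monomial symmetry (rows permuted by `σ` and scaled by
`c (inl k)`, columns permuted by `τ` and scaled by `c (inr j)`) to the pencil: automorphisms
`B`, `C` of `V` with `B Λ = Λ C` and `B A_{kj} = c_{inl k} c_{inr j} · A_{σ k, τ j} C` (the tree's
`IsEquivariantDetRepr` unpacked on the constant and the linear part; LR17 Def. 1.3 with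
`𝔾_A ⊆ Stab Λ`, Def. 1.2, for the group `N(T^{GL(E)}) × N(T^{GL(F)})` of §2.1).  `σ = τ = 1` is a
lift of the torus element `diag(c_inl) ⊗ diag(c_inr)`, `c = 1` a lift of the permutation pair.
[cite: LandsbergRessayre2017, Def. 1.3] -/
structure Lift₂ (σ τ : Equiv.Perm (Fin m)) (c : Fin m ⊕ Fin m → K) where
  /-- the automorphism on the target side -/
  B : V ≃ₗ[K] V
  /-- the automorphism on the source side -/
  C : V ≃ₗ[K] V
  /-- the scalars are invertible -/
  c_ne : ∀ x, c x ≠ 0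
  /-- `B Λ = Λ C` -/
  comm_Λ : ∀ v, B (Λ v) = Λ (C v)
  /-- `B A_{kj} = c_{inl k} c_{inr j} · A_{σ k, τ j} C` -/
  comm_A : ∀ k j v, B (A k j v) = (c (Sum.inl k) * c (Sum.inr j)) • A (σ k) (τ j) (C v)

variable {Λ A}

/-- `inl (σ k) ∈ (σ ⊔ τ) S ↔ inl k ∈ S`. [folklore] -/
theorem inl_mem_map_sumCongr_iff {σ τ : Equiv.Perm (Fin m)} (S : Finset (Fin m ⊕ Fin m)) (k : Fin m) :
    Sum.inl (σ k) ∈ S.map (Equiv.sumCongr σ τ).toEmbedding ↔ Sum.inl k ∈ S := by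
  rw [Finset.mem_map_equiv]
  exact Iff.of_eq (congrArg (· ∈ S) (by simp [Equiv.sumCongr_symm, Equiv.sumCongr_apply]))

/-- `inr (τ j) ∈ (σ ⊔ τ) S ↔ inr j ∈ S`. [folklore] -/
theorem inr_mem_map_sumCongr_iff {σ τ : Equiv.Perm (Fin m)} (S : Finset (Fin m ⊕ Fin m)) (j : Fin m) :
    Sum.inr (τ j) ∈ S.map (Equiv.sumCongr σ τ).toEmbedding ↔ Sum.inr j ∈ S := by
  rw [Finset.mem_map_equiv]
  exact Iff.of_eq (congrArg (· ∈ S) (by simp [Equiv.sumCongr_symm, Equiv.sumCongr_apply]))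

namespace Lift₂

variable {σ τ : Equiv.Perm (Fin m)} {c : Fin m ⊕ Fin m → K} (L : Lift₂ Λ A σ τ c)

/-- The product scalar `c_{inl k} c_{inr j}` is non-zero. [folklore] -/
theorem cc_ne (L : Lift₂ Λ A σ τ c) (k j : Fin m) : c (Sum.inl k) * c (Sum.inr j) ≠ 0 :=
  mul_ne_zero (L.c_ne _) (L.c_ne _)

/-- The inverse lift lifts the inverse symmetry. [cite: LandsbergRessayre2017, Def. 1.3] -/
def symm : Lift₂ Λ A σ⁻¹ τ⁻¹ (fun x => (c ((Equiv.sumCongr σ τ)⁻¹ x))⁻¹) where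
  B := L.B.symm
  C := L.C.symm
  c_ne x := inv_ne_zero (L.c_ne _)
  comm_Λ v := by
    apply L.B.injective
    rw [LinearEquiv.apply_symm_apply, L.comm_Λ, LinearEquiv.apply_symm_apply]
  comm_A k j v := by
    apply L.B.injective
    have hk : σ (σ⁻¹ k) = k := σ.apply_symm_apply k
    have hj : τ (τ⁻¹ j) = j := τ.apply_symm_apply j
    rw [LinearEquiv.apply_symm_apply, map_smul, L.comm_A, LinearEquiv.apply_symm_apply, hk, hj,
      smul_smul]
    have e : (c ((Equiv.sumCongr σ τ)⁻¹ (Sum.inl k)))⁻¹ * (c ((Equiv.sumCongr σ τ)⁻¹ (Sum.inr j)))⁻¹ *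
        (c (Sum.inl (σ⁻¹ k)) * c (Sum.inr (τ⁻¹ j))) = 1 := by
      have h1 : (Equiv.sumCongr σ τ)⁻¹ (Sum.inl k) = Sum.inl (σ⁻¹ k) := rfl
      have h2 : (Equiv.sumCongr σ τ)⁻¹ (Sum.inr j) = Sum.inr (τ⁻¹ j) := rfl
      rw [h1, h2, show ∀ x y : K, x⁻¹ * y⁻¹ * (x * y) = (x⁻¹ * x) * (y⁻¹ * y) from fun x y => by ring,
        inv_mul_cancel₀ (L.c_ne _), inv_mul_cancel₀ (L.c_ne _), one_mul]
    rw [e, one_smul]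

/-- `B Λ = Λ C` as linear maps. [cite: LandsbergRessayre2017, Def. 1.3] -/
theorem comp_Λ : (L.B : V →ₗ[K] V) ∘ₗ Λ = Λ ∘ₗ (L.C : V →ₗ[K] V) :=
  LinearMap.ext fun v => L.comm_Λ v

/-- `B A_{kj} = c_{inl k} c_{inr j} · A_{σ k, τ j} C` as linear maps. [cite: LandsbergRessayre2017, Def. 1.3] -/
theorem comp_A (k j : Fin m) :
    (L.B : V →ₗ[K] V) ∘ₗ A k j = (c (Sum.inl k) * c (Sum.inr j)) • (A (σ k) (τ j) ∘ₗ (L.C : V →ₗ[K] V)) :=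
  LinearMap.ext fun v => L.comm_A k j v

/-- `Λ⁻¹ (B P) = C (Λ⁻¹ P)`. [folklore] -/
theorem comap_map_eq (P : Submodule K V) :
    (P.map (L.B : V →ₗ[K] V)).comap Λ = (P.comap Λ).map (L.C : V →ₗ[K] V) := by
  ext w
  rw [Submodule.map_equiv_eq_comap_symm, Submodule.map_equiv_eq_comap_symm]
  simp only [Submodule.mem_comap, LinearEquiv.coe_coe]
  rw [show L.B.symm (Λ w) = Λ (L.C.symm w) from L.symm.comm_Λ w]

/-- `B (range Λ) = range Λ`. [folklore] -/
theorem map_range_eq : (LinearMap.range Λ).map (L.B : V →ₗ[K] V) = LinearMap.range Λ := by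
  rw [← LinearMap.range_comp, L.comp_Λ, LinearMap.range_comp, LinearEquiv.range, Submodule.map_top]

/-- `C (ker Λ) = ker Λ`. [folklore] -/
theorem map_ker_eq : (LinearMap.ker Λ).map (L.C : V →ₗ[K] V) = LinearMap.ker Λ := by
  rw [← Submodule.comap_bot, ← L.comap_map_eq, Submodule.map_bot]

/-- Covariance, first half: `𝒫_{(σ ⊔ τ) S} ⊆ B 𝒫_S`. [cite: LandsbergRessayre2017, §6] -/
theorem canon₂_map_le (S : Finset (Fin m ⊕ Fin m)) :
    canon₂ Λ A (S.map (Equiv.sumCongr σ τ).toEmbedding) ≤ (canon₂ Λ A S).map (L.B : V →ₗ[K] V) := by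
  apply canon₂_le
  intro k' j' hk' hj'
  obtain ⟨k, rfl⟩ : ∃ k, σ k = k' := σ.surjective k'
  obtain ⟨j, rfl⟩ : ∃ j, τ j = j' := τ.surjective j'
  rw [inl_mem_map_sumCongr_iff] at hk'
  rw [inr_mem_map_sumCongr_iff] at hj'
  rw [L.comap_map_eq, ← Submodule.map_comp, ← Submodule.map_smul _ _ _ (L.cc_ne k j), ← L.comp_A,
    Submodule.map_comp]
  exact Submodule.map_mono (isClosedUnder₂_canon₂ S k j hk' hj')

/-- Covariance, second half: `B 𝒫_S ⊆ 𝒫_{(σ ⊔ τ) S}`. [cite: LandsbergRessayre2017, §6] -/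
theorem map_canon₂_le (S : Finset (Fin m ⊕ Fin m)) :
    (canon₂ Λ A S).map (L.B : V →ₗ[K] V) ≤ canon₂ Λ A (S.map (Equiv.sumCongr σ τ).toEmbedding) := by
  rw [Submodule.map_le_iff_le_comap]
  apply canon₂_le
  intro k j hk hj
  have hkσ : Sum.inl (σ k) ∈ S.map (Equiv.sumCongr σ τ).toEmbedding := (inl_mem_map_sumCongr_iff S k).2 hk
  have hjτ : Sum.inr (τ j) ∈ S.map (Equiv.sumCongr σ τ).toEmbedding := (inr_mem_map_sumCongr_iff S j).2 hj
  rw [← Submodule.map_le_iff_le_comap, ← Submodule.map_comp, L.comp_A,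
    Submodule.map_smul _ _ _ (L.cc_ne k j), Submodule.map_comp,
    ← Submodule.comap_comp, L.comp_Λ, Submodule.comap_comp,
    Submodule.map_comap_eq_of_surjective L.C.surjective]
  exact isClosedUnder₂_canon₂ _ (σ k) (τ j) hkσ hjτ

/-- **Covariance**: `B 𝒫_S = 𝒫_{(σ ⊔ τ) S}` — the canonical subspaces are permuted by the lifts
exactly as LR's weight spaces (LR17 §6: `Wt(T̃, W)` is an orbit); for a torus lift (`σ = τ = 1`)
this says that `𝒫_S` is `B`-stable. [cite: LandsbergRessayre2017, §6] -/
theorem map_canon₂_eq (S : Finset (Fin m ⊕ Fin m)) :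
    (canon₂ Λ A S).map (L.B : V →ₗ[K] V) = canon₂ Λ A (S.map (Equiv.sumCongr σ τ).toEmbedding) :=
  le_antisymm (L.map_canon₂_le S) (L.canon₂_map_le S)

/-- Transport of the escape property: `𝒫_{(σ⊔τ)S} ⊆ range Λ ↔ 𝒫_S ⊆ range Λ`.
[cite: LandsbergRessayre2017, §6] -/
theorem canon₂_le_range_iff (L : Lift₂ Λ A σ τ c) (S : Finset (Fin m ⊕ Fin m)) :
    canon₂ Λ A (S.map (Equiv.sumCongr σ τ).toEmbedding) ≤ LinearMap.range Λ ↔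
      canon₂ Λ A S ≤ LinearMap.range Λ := by
  rw [← L.map_canon₂_eq]
  conv_lhs => rw [← L.map_range_eq]
  exact Submodule.map_le_map_iff_of_injective L.B.injective _ _

/-- Transport of "`𝒫_S ⊆ Σ_{S' ⊊ S} 𝒫_{S'}`" along a lift (one direction; the other is the same
statement for the inverse lift). [cite: LandsbergRessayre2017, §6] -/
theorem canon₂_le_iSup_ssubsets_transfer (L : Lift₂ Λ A σ τ c) {S : Finset (Fin m ⊕ Fin m)}
    (h : canon₂ Λ A S ≤ ⨆ (S' : Finset (Fin m ⊕ Fin m)) (_ : S' ⊂ S), canon₂ Λ A S') :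
    canon₂ Λ A (S.map (Equiv.sumCongr σ τ).toEmbedding) ≤
      ⨆ (T : Finset (Fin m ⊕ Fin m)) (_ : T ⊂ S.map (Equiv.sumCongr σ τ).toEmbedding), canon₂ Λ A T := by
  rw [← L.map_canon₂_eq]
  refine (Submodule.map_mono h).trans ?_
  rw [Submodule.map_iSup]
  refine iSup_le fun S' => ?_
  rw [Submodule.map_iSup]
  refine iSup_le fun hS' => ?_
  rw [L.map_canon₂_eq]
  have : S'.map (Equiv.sumCongr σ τ).toEmbedding ⊂ S.map (Equiv.sumCongr σ τ).toEmbedding :=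
    Finset.map_ssubset_map.2 hS'
  exact le_biSup (fun T => canon₂ Λ A T) this

/-- For a torus lift (`σ = τ = 1`): `𝒫_S` is `B`-stable. [cite: LandsbergRessayre2017, §6] -/
theorem map_canon₂_eq_self (L : Lift₂ Λ A 1 1 c) (S : Finset (Fin m ⊕ Fin m)) :
    (canon₂ Λ A S).map (L.B : V →ₗ[K] V) = canon₂ Λ A S := by
  rw [L.map_canon₂_eq]
  congr 1
  have : (Equiv.sumCongr (1 : Equiv.Perm (Fin m)) (1 : Equiv.Perm (Fin m))).toEmbedding =
      Function.Embedding.refl _ := by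
    ext x; rcases x with x | x <;> rfl
  rw [this, Finset.map_refl]

end Lift₂

end Lift

end LRPencil

end Literature.Computability.AlgebraicComplexity
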